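import Summits.CriticalPhenomena.PercolationContinuityZ3.Theorems.PercNearOneGluingNoHeavyQuantFarSunTKSwap
import HarnessLib

/-!
# FAR beyond trees: the certificate `T_K` — HAIR REVEALING: from the combinatorial core to the hair-averaged pair sums

builds on p205010 (kernel theorem, internal audit signed; external expert review pending)

Support file (`--supports stmt-CriticalPhenomena-4575`), seat `prim-cert-1` (gen 23); memo `prim-cert-1/FROM-prim-cert-1-g23-SUNFAR-ALL-K.md` §2.
For the four arcsets `A₁ = cov l a`, `B₁ = cov m b`, `A₂ = cov l b`, `B₂ = cov m a` (`m ≤ l`, `a ≤ b ≤ K`) and hair weights `h ∈ [0,1]`: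
* `TK.hw_insert_of_not_mem`, `TK.hw_insert_insert` — peeling one hair weight off `TK.hw`.
* `TK.reveal_step` — revealing one random hair `x`: with `Ω(S,Z,T) = Σ_{Q,Q' ⊆ S} hw Q · hw Q' · Σ_{J ⊆ T} [W(A₁∩(Z∪Q∪J), B₁∩(Z∪Q'∪T∖J)) + W(A₂∩…, B₂∩…)]`,
  `Ω(S+x,Z,T) = (1−h x)²·Ω(S,Z,T) + h x(1−h x)·Ω(S,Z,T+x) + (h x)²·Ω(S,Z+x,T)` (the two split outcomes of `x` are grouped and summed over
  its owner — this is the law-level symmetrisation in the hairs).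
* **`TK.reveal_nonneg`** — hence `Ω(S,Z,T) ≥ 0` for all pairwise disjoint `S, Z, T ⊆ range K`, from the core `TK.pairSum_swap_nonneg` (`S = ∅`).
No sorries; standard axioms.  Elementary [this work].
-/

noncomputable section

namespace Summit.CriticalPhenomena.PercolationContinuityZ3.Theorems.HairyCycle

namespace TK

open Finset

variable {K : ℕ}

/-! ## Peeling a hair weight -/

open scoped Classical in
/-- `hw (insert x S) h Q = (1 − h x) · hw S h Q` for `Q ⊆ S`, `x ∉ S`. [this work] -/
theorem hw_insert_of_not_mem {S Q : Finset ℕ} {x : ℕ} (h : ℕ → ℝ) (hx : x ∉ S) (hQ : Q ⊆ S) :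
    hw (insert x S) h Q = (1 - h x) * hw S h Q := by
  unfold hw
  rw [Finset.prod_insert hx, if_neg (fun hq => hx (hQ hq))]

open scoped Classical in
/-- `hw (insert x S) h (insert x Q) = h x · hw S h Q` for `x ∉ S`. [this work] -/
theorem hw_insert_insert {S Q : Finset ℕ} {x : ℕ} (h : ℕ → ℝ) (hx : x ∉ S) :
    hw (insert x S) h (insert x Q) = h x * hw S h Q := by
  unfold hw
  rw [Finset.prod_insert hx, if_pos (Finset.mem_insert_self x Q)]
  congr 1
  refine Finset.prod_congr rfl fun k hk => ?_
  have hkx : k ≠ x := fun e => hx (e ▸ hk)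
  simp only [Finset.mem_insert, hkx, false_or]

open scoped Classical in
/-- `hw S h Q ≥ 0` when `h ∈ [0,1]` on `S`. [this work] -/
theorem hw_nonneg {S : Finset ℕ} {h : ℕ → ℝ} (hh : ∀ k ∈ S, 0 ≤ h k ∧ h k ≤ 1) (Q : Finset ℕ) : 0 ≤ hw S h Q := by
  unfold hw
  refine Finset.prod_nonneg fun k hk => ?_
  split_ifs
  · exact (hh k hk).1
  · linarith [(hh k hk).2]

/-! ## The revealing identity -/

section Reveal

variable (A1 B1 A2 B2 : Finset ℕ)

/-- The integer pair sum of the two pairs for given sure-hair sets of the two copies and split hairs `T`. [this work] -/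
def corePS (K : ℕ) (HA HB T : Finset ℕ) : ℤ :=
  ∑ J ∈ T.powerset, (Wcert K (A1 ∩ (HA ∪ J)) (B1 ∩ (HB ∪ (T \ J))) + Wcert K (A2 ∩ (HA ∪ J)) (B2 ∩ (HB ∪ (T \ J))))

/-- The hair-averaged quantity `Ω(S, Z, T)`: hairs in `S` random in both copies, `Z` sure in both, `T` split. [this work] -/
def Omega (K : ℕ) (h : ℕ → ℝ) (S Z T : Finset ℕ) : ℝ :=
  ∑ Q ∈ S.powerset, ∑ Q' ∈ S.powerset, hw S h Q * hw S h Q' * (corePS A1 B1 A2 B2 K (Z ∪ Q) (Z ∪ Q') T : ℝ)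

/-- Grouping the two split outcomes of a hair `x ∉ T`: `corePS (HA + x) HB T + corePS HA (HB + x) T = corePS HA HB (T + x)`. [this work] -/
theorem corePS_insert {HA HB T : Finset ℕ} {x : ℕ} (hxT : x ∉ T) :
    corePS A1 B1 A2 B2 K (insert x HA) HB T + corePS A1 B1 A2 B2 K HA (insert x HB) T = corePS A1 B1 A2 B2 K HA HB (insert x T) := by
  unfold corePS
  rw [Finset.sum_powerset_insert hxT, add_comm]
  congr 1
  · refine Finset.sum_congr rfl fun J hJ => ?_
    rw [Finset.mem_powerset] at hJ
    rw [Finset.insert_sdiff_of_notMem _ (fun hx => hxT (hJ hx)), Finset.union_insert, Finset.insert_union]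
  · refine Finset.sum_congr rfl fun J hJ => ?_
    rw [Finset.mem_powerset] at hJ
    rw [Finset.insert_sdiff_insert, Finset.sdiff_insert_of_notMem hxT, Finset.union_insert, Finset.insert_union]

/-- **The revealing identity**: for `x ∉ S ∪ T`,
`Ω(S+x,Z,T) = (1−h x)²·Ω(S,Z,T) + h x (1−h x)·Ω(S,Z,T+x) + (h x)²·Ω(S,Z+x,T)`. [this work] -/
theorem reveal_step (h : ℕ → ℝ) {S Z T : Finset ℕ} {x : ℕ} (hxS : x ∉ S) (hxT : x ∉ T) :
    Omega A1 B1 A2 B2 K h (insert x S) Z T =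
      (1 - h x) ^ 2 * Omega A1 B1 A2 B2 K h S Z T + h x * (1 - h x) * Omega A1 B1 A2 B2 K h S Z (insert x T) +
        h x ^ 2 * Omega A1 B1 A2 B2 K h S (insert x Z) T := by
  classical
  unfold Omega
  rw [Finset.sum_powerset_insert hxS]
  have inner : ∀ Q ∈ S.powerset,
      ∑ Q' ∈ (insert x S).powerset, hw (insert x S) h Q * hw (insert x S) h Q' * (corePS A1 B1 A2 B2 K (Z ∪ Q) (Z ∪ Q') T : ℝ) +
      ∑ Q' ∈ (insert x S).powerset, hw (insert x S) h (insert x Q) * hw (insert x S) h Q' *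
        (corePS A1 B1 A2 B2 K (Z ∪ insert x Q) (Z ∪ Q') T : ℝ) =
      ∑ Q' ∈ S.powerset, ((1 - h x) ^ 2 * (hw S h Q * hw S h Q' * (corePS A1 B1 A2 B2 K (Z ∪ Q) (Z ∪ Q') T : ℝ)) +
        h x * (1 - h x) * (hw S h Q * hw S h Q' * (corePS A1 B1 A2 B2 K (Z ∪ Q) (Z ∪ Q') (insert x T) : ℝ)) +
        h x ^ 2 * (hw S h Q * hw S h Q' * (corePS A1 B1 A2 B2 K (insert x Z ∪ Q) (insert x Z ∪ Q') T : ℝ))) := by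
    intro Q hQ
    rw [Finset.mem_powerset] at hQ
    rw [Finset.sum_powerset_insert hxS, Finset.sum_powerset_insert hxS, ← Finset.sum_add_distrib, ← Finset.sum_add_distrib,
      ← Finset.sum_add_distrib]
    refine Finset.sum_congr rfl fun Q' hQ' => ?_
    rw [Finset.mem_powerset] at hQ'
    rw [hw_insert_of_not_mem h hxS hQ, hw_insert_of_not_mem h hxS hQ', hw_insert_insert h hxS, hw_insert_insert h hxS]
    have e1 : Z ∪ insert x Q = insert x (Z ∪ Q) := Finset.union_insert x Z Q
    have e2 : Z ∪ insert x Q' = insert x (Z ∪ Q') := Finset.union_insert x Z Q'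
    have e3 : insert x Z ∪ Q = insert x (Z ∪ Q) := Finset.insert_union x Z Q
    have e4 : insert x Z ∪ Q' = insert x (Z ∪ Q') := Finset.insert_union x Z Q'
    rw [e1, e2, e3, e4, ← corePS_insert A1 B1 A2 B2 hxT]
    push_cast
    ring
  rw [← Finset.sum_add_distrib, Finset.sum_congr rfl inner]
  simp only [Finset.sum_add_distrib, ← Finset.mul_sum]

/-- **Hair revealing**: `Ω(S,Z,T) ≥ 0` for pairwise disjoint `S, Z, T ⊆ range K` when the arcsets are a nested pair and its suffix swap
(`A₁ = cov l a`, `B₁ = cov m b`, `A₂ = cov l b`, `B₂ = cov m a`, `m ≤ l`, `a ≤ b ≤ K`) and `h ∈ [0,1]` — by induction on `S` from the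
combinatorial core `TK.pairSum_swap_nonneg`. [this work] -/
theorem reveal_nonneg (hK : 4 ≤ K) {h : ℕ → ℝ} (hh : ∀ k, k < K → 0 ≤ h k ∧ h k ≤ 1) {l m a b : ℕ} (hml : m ≤ l) (hab : a ≤ b)
    (hbK : b ≤ K) : ∀ (S Z T : Finset ℕ), S ⊆ range K → Z ⊆ range K → T ⊆ range K → Disjoint S Z → Disjoint S T → Disjoint Z T →
      0 ≤ Omega (cov K l a) (cov K m b) (cov K l b) (cov K m a) K h S Z T := by
  classical
  intro S
  induction S using Finset.induction_on with
  | empty =>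
    intro Z T _ hZ hT _ _ hZT
    unfold Omega corePS
    simp only [Finset.powerset_empty, Finset.sum_singleton, Finset.union_empty]
    have h0 : hw (∅ : Finset ℕ) h ∅ = 1 := by unfold hw; simp
    rw [h0, one_mul, one_mul, Finset.sum_add_distrib]
    exact_mod_cast pairSum_swap_nonneg hK hml hab hbK _ Z T hZ hT hZT rfl
  | insert x S hxS ih =>
    intro Z T hS hZ hT hSZ hST hZT
    have hxK : x < K := Finset.mem_range.1 (hS (Finset.mem_insert_self x S))
    have hxZ : x ∉ Z := Finset.disjoint_left.1 hSZ (Finset.mem_insert_self x S)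
    have hxT : x ∉ T := Finset.disjoint_left.1 hST (Finset.mem_insert_self x S)
    have hS' : S ⊆ range K := (Finset.subset_insert x S).trans hS
    have hSZ' : Disjoint S Z := hSZ.mono_left (Finset.subset_insert x S)
    have hST' : Disjoint S T := hST.mono_left (Finset.subset_insert x S)
    rw [reveal_step _ _ _ _ h hxS hxT]
    have h1 := ih Z T hS' hZ hT hSZ' hST' hZT
    have h2 := ih Z (insert x T) hS' hZ (Finset.insert_subset (Finset.mem_range.2 hxK) hT) hSZ'
      (Finset.disjoint_insert_right.2 ⟨hxS, hST'⟩) (Finset.disjoint_insert_right.2 ⟨hxZ, hZT⟩)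
    have h3 := ih (insert x Z) T hS' (Finset.insert_subset (Finset.mem_range.2 hxK) hZ) hT
      (Finset.disjoint_insert_right.2 ⟨hxS, hSZ'⟩) hST' (Finset.disjoint_insert_left.2 ⟨hxT, hZT⟩)
    have hx0 := (hh x hxK).1
    have hx1 := (hh x hxK).2
    have hx2 : 0 ≤ h x * (1 - h x) := mul_nonneg hx0 (by linarith)
    exact add_nonneg (add_nonneg (mul_nonneg (sq_nonneg _) h1) (mul_nonneg hx2 h2)) (mul_nonneg (sq_nonneg _) h3)

end Reveal

end TK

end Summit.CriticalPhenomena.PercolationContinuityZ3.Theorems.HairyCycle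

end
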